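import Summits.BirchSwinnertonDyer.BirchSwinnertonDyer.Theses.QuadraticBranchSignedControl
import Summits.BirchSwinnertonDyer.BirchSwinnertonDyer.Theorems.QuadraticBranchSignedControlPlusEtaNonsurjFineRoadCM
import HarnessLib

/-!
# Route `QuadraticBranchSignedControl` (rung K8, cell `bsd-potss`), residual crux
# `PlusEtaMainConjectureNonsurj` (stmt-BirchSwinnertonDyer-19606): the crux BY NAME from statement (A) on the
# additive partners, the analytic `μ`, and the Eisenstein inclusion on the non-CM rows — a candidate `_of` for a
# skeleton v6 without the CM primary stub (seat k8eta-c2 g7)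

WHAT. Skeleton v5 (plan g23) concludes the crux from FOUR primary stubs: `stub_etaMC_thm22` (cite, Kobayashi Thm.
2.2 at `η`), `stub_etaMC_cm` ((C1⁺_η) on the CM twists), `stub_etaMC_nonCM_upper` (the INTEGRAL Kato-side inclusion
on the non-CM small-image twists), `stub_etaMC_nonCM_lower` (the Eisenstein inclusion (E⁺_η) there); the sub-cut
`stub_conjA_partners` + the displayed analytic `μ` already give the upper inclusion on EVERY row
(`etaUpper_r0r1_of_conjA_of_analyticMu`, k8eta-c2 g6) and — by part 5 of the fine road
(`EtaFineRoad.etaMC_cm_of_bt26_of_conjA_partners_of_analyticMu`, k8eta-c2 g7, modulo Burungale–Tian 2026 Thm. 2.6)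
— the CM stub. THIS FILE composes them into ONE theorem concluding the crux BY NAME:

`plusEtaMainConjectureNonsurj_of_conjA_partners_of_analyticMu_of_nonCM_lower`:
  `PlusEtaMainConjectureNonsurj` ⟸ [named facts `h22`, `h41`, `h6273` (Kobayashi 2003), `h26` (Burungale–Tian 2026)]
  + [the TEXT of `Sig.stub_conjA_partners` — statement (A) of Coates–Sujatha for the additive partner of every
  non-onto Gss2 twist] + [the displayed analytic input `μ(L_p⁺(V,η,X)) = 0` on every non-onto Gss2 twist (the
  TEXT of v5's `AnalyticEtaMuZeroAt V p`; certified per row, k8eta-c2 g3, 537/537)] + [the TEXT of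
  `Sig.stub_etaMC_nonCM_lower`].

So a skeleton v6 may read: stubs = `stub_etaMC_thm22` (cite) · `stub_conjA_partners` · `stub_etaMC_nonCM_lower`
(+ `stub_etaMC_r0_lowerBSD` for the separate rank-0 sub-cut), with `h26 h41 h6273` named and the analytic `μ`
displayed; the CM stub and the non-CM upper stub are RETIRED into (A). Residual content of 19606 modulo print then
= Conjecture A on the additive Gss2 partners (K9/KT's open input too) + (E⁺_η) on the non-CM rows of rank ≥ 1 with
non-prime `L_p⁺` (on the non-CM rank-0 rows (E⁺_η) ⟸ upper + L₀, p464359; on prime-`L` rank-1 rows it is free).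

HONEST FRAMING (cell `bsd-potss`; FULL-BSD rank ≤ 1 programme, HUMAN RULING D-0036/D-0074): a BOOKKEEPING
THEOREM — no definition, no named fact minted, no `sorry`, axioms standard. CONDITIONAL on the named facts
(`h22`, `h41`, `h6273`, `h26` — none proved in the tree) and on the two OPEN stub texts taken as hypotheses and the
displayed analytic `μ`. It does NOT prove the crux: it is the composition a v6 skeleton would register as `_of`.
Nothing is booked; `BSD(W,p)` is claimed for no pair. `--supports stmt-BirchSwinnertonDyer-19606`.

References: [Kobayashi2003] §4 Even main conjecture and Thm. 4.1 (p. 8), Thm. 2.2 (p. 5), Thm. 7.3 i) (7.21),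
Cor. 7.2 (p. 13); [BurungaleTian2026] Thm. 2.6, Rem. 2.7 (p. 5); [CoatesSujatha2005] §3 statement (A);
[PollackRubin2004] Theorem and remark p. 448; [GreenbergVatsal2000] p. 2 (2).
-/

set_option autoImplicit false
set_option linter.dupNamespace false

noncomputable section

open scoped Classical

open CongruenceSubgroup Field Function NumberField IsDedekindDomain WeierstrassCurve
open Literature.NumberTheory.EllipticCurves
open Literature.NumberTheory.EllipticCurves.ModularForms
open Literature.NumberTheory.EllipticCurves.Rank1Residual
open Literature.NumberTheory.EllipticCurves.Rank1Residual.Typed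
open Literature.NumberTheory.GaloisRepresentations
open Literature.NumberTheory.GaloisCohomology
open Literature.NumberTheory.EllipticCurves.IwasawaAlgebra
open Literature.NumberTheory.EllipticCurves.IwasawaDual ZpExtension
open Literature.NumberTheory.EllipticCurves.GreenbergVatsal2000
open Summit.BirchSwinnertonDyer.Rank1Residual.Additive
open Summit.BirchSwinnertonDyer.BirchSwinnertonDyer.Theses.QuadraticBranchSignedControl

namespace Summit.BirchSwinnertonDyer.BirchSwinnertonDyer.Theorems

namespace EtaFineRoad

/-- **Crux 19606 BY NAME from (A) on the additive partners + the analytic `μ` + the Eisenstein inclusion on the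
non-CM rows**, modulo Kobayashi's Thm. 2.2η / 4.1η (rational clause) / 6.2–6.3–7.3 i) at `η` and Burungale–Tian's
Thm. 2.6. For every `p ≥ 5` and every globally minimal `V/ℚ` good at `p` with `a_p(V) = 0` whose `p`-adic tower is
not onto: if `V` has CM, part 5 of the fine road (`etaMC_cmRows_of_bt26_of_conjA_of_analyticMu`) gives (C1⁺_η)(V,p)
from (A) at the partner `W` (`TwistPartner.exists_isGloballyMinimal_pStarPartner`) and the analytic `μ`; otherwise
the integral upper inclusion comes from (A) + analytic `μ` (`etaUpperIntegral_of_conjA_of_analyticMu`, image-free)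
and (E⁺_η) from the hypothesis `hlow`, glued by `quadraticBranchPlusEtaMainConjectureAt_of_thm22_of_upper_of_etaLowerInclusion`.
The hypotheses `hA`, `hμan`, `hlow` are VERBATIM the texts of skeleton v5's `Sig.stub_conjA_partners`,
`AnalyticEtaMuZeroAt` (quantified over the crux's rows) and `Sig.stub_etaMC_nonCM_lower`. CONDITIONAL; the crux is
NOT proved; nothing booked. [cite: Kobayashi2003, §4 Even main conjecture and Thm. 4.1 (p. 8), Thm. 2.2 (p. 5), Thm. 7.3 i) (p. 13)]
[cite: BurungaleTian2026, Thm. 2.6 and Rem. 2.7 (p. 5)] [cite: CoatesSujatha2005, §3 statement (A)] -/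
theorem plusEtaMainConjectureNonsurj_of_conjA_partners_of_analyticMu_of_nonCM_lower
    (h22 : Kobayashi2003.thm22_etaSignedSelmerDual_finite_torsion)
    (h41 : Kobayashi2003.thm41_plusEtaCharIdeal_dvd)
    (h6273 : Kobayashi2003.thm62_63_73_etaColemanPoitouTate)
    (h26 : BurungaleTian2026.thm26_etaKatoSequences_charIdeal_upToP_of_cm)
    (hA : ∀ (V : WeierstrassCurve ℚ) [V.IsElliptic] [V.IsGloballyMinimal] (W : WeierstrassCurve ℚ) [W.IsElliptic]
      [W.IsGloballyMinimal] (C : VariableChange ℚ) (p : ℕ) [Fact p.Prime],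
      5 ≤ p → C • W.quadraticTwist ((-1) ^ (p / 2) * p) = V →
      V.HasGoodReductionAtPrime p → V.frobeniusTrace p = 0 →
      ¬ (∀ m : ℕ, V.HasSurjectiveModNGaloisRep (p ^ m : ℕ)) →
      ∀ (κ : ZpExtension ℚ p), κ.IsCyclotomic →
        ∃ (γ : absoluteGaloisGroup ℚ) (D : W.FineSelmerDualData κ γ),
          Module.Finite ℤ_[p] (RestrictScalars ℤ_[p] (IwasawaAlgebra p) D.X))
    (hμan : ∀ (V : WeierstrassCurve ℚ) [V.IsElliptic] [V.IsGloballyMinimal] (p : ℕ) [Fact p.Prime],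
      5 ≤ p → V.HasGoodReductionAtPrime p → V.frobeniusTrace p = 0 →
      ¬ (∀ m : ℕ, V.HasSurjectiveModNGaloisRep (p ^ m : ℕ)) →
      ∀ {N : ℕ} [NeZero N] {f : CuspForm (Gamma0 N) 2}, IsNewformOf V f →
        ∀ (ϖ : ℚ), (if Even (p / 2) then (ϖ : ℝ) * V.realPeriodRat = plusPeriod f
            else (ϖ : ℝ) * V.imaginaryPeriodRat = minusPeriod f) →
        ∀ (Lη : IwasawaAlgebra p), IsQuadraticBranchPlusLFunction f p ϖ Lη → HasUnitContent Lη)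
    (hlow : ∀ (V : WeierstrassCurve ℚ) [V.IsElliptic] [V.IsGloballyMinimal] (p : ℕ) [Fact p.Prime],
      5 ≤ p → V.HasGoodReductionAtPrime p → V.frobeniusTrace p = 0 →
      ¬ (∀ m : ℕ, V.HasSurjectiveModNGaloisRep (p ^ m : ℕ)) → ¬ V.HasCM →
        QuadraticBranchPlusEtaLowerInclusionAt V p) :
    PlusEtaMainConjectureNonsurj := by
  intro V _ _ p _ hp5 hgood hap hns
  obtain ⟨W, _, _, C, hCV⟩ := TwistPartner.exists_isGloballyMinimal_pStarPartner V p
  by_cases hCM : V.HasCM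
  · exact etaMC_cmRows_of_bt26_of_conjA_of_analyticMu h26 h22 h6273 V p hp5 hgood hap hns hCM W C hCV
      (hA V W C p hp5 hCV hgood hap hns) (hμan V p hp5 hgood hap hns)
  · exact quadraticBranchPlusEtaMainConjectureAt_of_thm22_of_upper_of_etaLowerInclusion h22
      (etaUpperIntegral_of_conjA_of_analyticMu W p h22 h41 h6273 V C hCV (hA V W C p hp5 hCV hgood hap hns)
        (hμan V p hp5 hgood hap hns))
      (hlow V p hp5 hgood hap hns hCM)

end EtaFineRoad

end Summit.BirchSwinnertonDyer.BirchSwinnertonDyer.Theorems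

end
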